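import Summits.BirchSwinnertonDyer.Rank1Residual.X11b.KolyvaginReciprocityOfPoitouTate
import Literature.NumberTheory.EllipticCurves.HeegnerPointsKolyvaginPrimaryProp82Proofs
import Literature.NumberTheory.EllipticCurves.HeegnerPointsKolyvaginGoodReductionProofs
import HarnessLib

/-!
# T1 JET (cell `bsd-jet`), road K, Ш-half of Jetchev Cor. 1.5 at `p ∣ N` — Gross 1991 Prop. 8.2 at
# level `p` (written `p^1`), the `h2` input of the divided descent, from Poitou–Tate

HONEST FRAMING (programme file `BSD-LIT2PART-PROGRAMME-v1.md` §HONESTY, verbatim): «no tranche here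
proves BSD; ARM L moves the LITERAL column of an r ≤ 1 census into the kernel-proved-modulo-named-print
column.» THEOREMS ONLY (seat `bsd-jet-pv-1`, session g9; `--supports stmt-BirchSwinnertonDyer-14418`,
helper); nothing is booked; 0 classes move. CONDITIONAL on the named fact
`poitouTate_sum_localTatePairing_eq_zero K` (Poitou–Tate, Milne *ADT* I Thm. 4.10(b) with Cor. 2.3;
cite-only), exactly as x11b's `kolyvaginReciprocityM_of_poitouTate`.

WHAT. The field `prop82` of `KolyvaginDescent.Hypotheses` (Gross 1991 Prop. 8.2: a `ν`-eigenclass `d`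
of `H¹(K, E[p])`, Selmer off the place `λ` of a Kolyvagin prime `ℓ` and NOT Selmer at `λ`, forces
`s_λ = 0` for every `ν`-eigenclass `s ∈ Sel_p(E/K)`), in the `h2` shape of
`JET.DividedDescent.exists_hypotheses_of_localData_of_kol` at the level `n = p^1` where the divided
classes live. It is the case `M = 1`, `a = 0` of McCallum's Lemma 5.3 with Prop. 2.2 — the tree's
`lemma_5_3_descent_of_reciprocity` (`HeegnerPointsKolyvaginPrimaryProp82Proofs`, PROVED) — fed with
Kolyvagin reciprocity `(R)_1` at `λ`, which x11b derived from Poitou–Tate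
(`KolyvaginReciprocity.kolyvaginReciprocityM_of_poitouTate`, PROVED modulo `hPT`). The Heegner point
`P` enters only through the good reduction of `E/K` at the Kolyvagin primes
(`IsKolyvaginPrime.not_mem_badPlaces`) and the standing hypotheses of the reciprocity supplier.
References: [cite: GrossLMS1991, Prop. 8.2 (with Prop. 8.1, (7.6))] [cite: McCallumLMS1991, §2 Prop. 2.2,
§5 Lemma 5.3] [cite: MilneADT2006, Ch. I Thm. 4.10(b), Cor. 2.3]. Design: no definitions; `K : Type u`.
Axioms: `propext`, `Classical.choice`, `Quot.sound`.
-/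

set_option autoImplicit false

noncomputable section

open scoped Classical

open WeierstrassCurve NumberField IsDedekindDomain Literature.NumberTheory.EllipticCurves
  Literature.NumberTheory.GaloisCohomology
  Summit.BirchSwinnertonDyer.Rank1Residual.X11b

universe u

namespace Summit.BirchSwinnertonDyer.Rank1Residual.JET.DividedDescent

variable {N : ℕ} [NeZero N] {W : WeierstrassCurve ℚ} {K : Type u} [Field K] [NumberField K]

/-- **Gross 1991 Prop. 8.2 at level `p^1`, from Poitou–Tate** (the `h2` input of
`exists_hypotheses_of_localData_of_kol` at `n = p^1`): for `E/ℚ` non-CM, `K` imaginary quadratic with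
`d_K ∉ {−3, −4}` and the Heegner hypothesis for `N`, a non-torsion Heegner point `P`, `p` odd with
`ρ̄_{E,p}` onto, `c ≠ 1` in `Aut(K/ℚ)`; for every Kolyvagin prime `ℓ` with place `λ`, every sign `ν`,
every `ν`-eigenclass `d ∈ H¹(K, E[p])` Selmer at the finite places `≠ λ` and at infinity but NOT at `λ`,
and every `ν`-eigenclass `s ∈ Sel_p(E/K)`: `s_λ = 0`. Proof: `lemma_5_3_descent_of_reciprocity` at
`M = 1`, `q = p^1`, `a = 0`, with `(R)_1` from `kolyvaginReciprocityM_of_poitouTate` and good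
reduction at `λ` from `IsKolyvaginPrime.not_mem_badPlaces`. CONDITIONAL on `hPT`.
[cite: GrossLMS1991, Prop. 8.2] [cite: McCallumLMS1991, §2 Prop. 2.2, §5 Lemma 5.3]
[cite: MilneADT2006, Ch. I Thm. 4.10(b)] -/
theorem prop82_levelOne_of_poitouTate (hPT : poitouTate_sum_localTatePairing_eq_zero K)
    [W.IsElliptic] (hE : ¬ W.HasCM) (hK : IsImaginaryQuadratic K)
    (hD : NumberField.discr K ≠ -3 ∧ NumberField.discr K ≠ -4)
    (hH : SatisfiesHeegnerHypothesis N K)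
    {P : (W.baseChange K).toAffine.Point} (hP : IsHeegnerPoint N W K P) (hnt : ¬ IsOfFinAddOrder P)
    {p : ℕ} (hp : p.Prime) (hp2 : p ≠ 2) (hρ : W.HasSurjectiveModNGaloisRep p)
    {c : K ≃ₐ[ℚ] K} (hc : c ≠ 1)
    {ℓ : ℕ} (hℓ : IsKolyvaginPrime N W K p ℓ) (ν : ℤ) (hν : ν = 1 ∨ ν = -1)
    (d : galH1Torsion (W.baseChange K) ((p ^ 1 : ℕ) : ℤ))
    (hd : conjAct W c ((p ^ 1 : ℕ) : ℤ) d = ν • d)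
    (hfin : ∀ v : HeightOneSpectrum (𝓞 K), (ℓ : 𝓞 K) ∉ v.asIdeal →
      d ∈ selmerLocalKer (W.baseChange K) (v.adicCompletion K) ((p ^ 1 : ℕ) : ℤ))
    (hinf : ∀ w : InfinitePlace K, d ∈ selmerLocalKer (W.baseChange K) w.Completion ((p ^ 1 : ℕ) : ℤ))
    (v : HeightOneSpectrum (𝓞 K)) (hv : (ℓ : 𝓞 K) ∈ v.asIdeal)
    (hdv : d ∉ selmerLocalKer (W.baseChange K) (v.adicCompletion K) ((p ^ 1 : ℕ) : ℤ))
    (s : galH1Torsion (W.baseChange K) ((p ^ 1 : ℕ) : ℤ))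
    (hs : s ∈ selmerGroup (W.baseChange K) ((p ^ 1 : ℕ) : ℤ))
    (hτs : conjAct W c ((p ^ 1 : ℕ) : ℤ) s = ν • s) :
    s ∈ (W.baseChange K).torsionLocalKer (v.adicCompletion K) ((p ^ 1 : ℕ) : ℤ) := by
  have hvw : v = hℓ.place := hℓ.mem_iff.mp hv
  subst hvw
  -- `Frob(ℓ) = Frob(∞)` on `K(E[p^1])` (the last conjunct of the Kolyvagin condition)
  have hfrob : FrobEqFrobInfty W K (p ^ 1) ℓ := by
    rw [pow_one]; exact hℓ.2.2.2.2.2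
  -- Kolyvagin reciprocity `(R)_1` at `λ`, from Poitou–Tate
  obtain ⟨A, _, e, halt, hnd, hRe⟩ :=
    KolyvaginReciprocity.kolyvaginReciprocityM_of_poitouTate N W K hPT hE hK hD hH hP hnt hp hp2 hρ
      (le_refl 1) hℓ hfrob
  -- good reduction of `E/K` at `λ`
  have hgood : (W.baseChange K).HasGoodReductionAt hℓ.place := by
    have h := IsKolyvaginPrime.not_mem_badPlaces (W := W) hP hℓ
    rwa [WeierstrassCurve.mem_badPlaces_iff, not_not] at h
  -- McCallum Lemma 5.3 ∕ Prop. 2.2 at `M = 1`, `a = 0`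
  have hdv' : ((p : ℤ) ^ 0) • d ∉
      selmerLocalKer (W.baseChange K) (hℓ.place.adicCompletion K) ((p ^ 1 : ℕ) : ℤ) := by
    rwa [pow_zero, one_smul]
  have key := lemma_5_3_descent_of_reciprocity W hK hp hp2 hc hℓ (M := 1) le_rfl (q := p ^ 1) rfl
    hfrob hgood e halt hnd hν hd hdv' hs hτs
    (fun 𝔔 h𝔔 F hF hFT σ hσ ↦ hRe s hs d hfin hinf 𝔔 h𝔔 F hF hFT σ hσ)
  have h0 : (1 : ℕ) - 1 - 0 = 0 := rfl
  rw [h0, pow_zero, one_smul] at key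
  exact key

end Summit.BirchSwinnertonDyer.Rank1Residual.JET.DividedDescent

end
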